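import Summits.QuantumFields.BalabanUV.Beta.GAN24.PlantedWordLaw

/-!
# `BalabanUV.Beta.GAN24.PlantedWordDefectLaw` — binder row G-an2-4 ∕ (CONV-C), routes C-R6° («VALUES») × R7 («TWO CURRENCIES»), PART 227:
# PART 217's PLANTED WORD LAW WITHOUT THE NESTING — the multiplier's NESTING DEFECT `E = JᴴD′J − D` (the block average of the finer profile minus the coarser one) enters
# through ONE new letter `q ≥ ‖G·E‖`: `‖Ã(G′D′W′)Ãᴴ − GDW‖ ≤ ακp_G + gαp_W + κq + fακ + gαf_W`; along a tower `OneStepAveragedLaw` ∕ `TowerLimitRate` with `q_k ≤ C_q ρ^k`.  With PART 226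
# (`‖𝒢_k·𝟙_{slab}‖ ≤ Cst√(3m)·(√(L⁻¹))^k`) this is the operator-currency step rate of the insertion word of an ALMOST NESTED bounded profile — one whose defect lives on a few coordinate
# slabs (census V204′ (ii)) (unit b2b-balaban-gan24-p3, gen 64; v1)

NOT IN PRINT; OUR PROOF ([folklore] finite-dimensional operator algebra in the `ℓ²`-operator norm over PART 217 (`sandwich_eq`), `Spine/CovariantAveragingTower` (`OneStepAveragedLaw`,
`TowerLimitRate`, `towerLimitRate_of_oneStepAveragedLaw`), `Spine/BackgroundResolventTower` (`FreeTowerLaws`, `opNorm_normalised_le`) BY NAME; [King1986] Lemma 4.5 (4.32) p. 674 «replace one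
by one every factor» is the printed pattern, method reference only; nothing printed is a hypothesis).
HONEST FRAMING (cell contract, verbatim): «discharging `BetaPertH` makes Bałaban's UV stability UNCONDITIONAL — a real constructive-QFT result; it is NOT the
continuum limit and NOT the Clay problem.»  HONEST DEPENDENCY (verbatim): «continuum YM on T⁴ ⇐ BetaPertH ∧ nine spine estimates (0/9 proved); BetaPertH ⇐
(D1) ∧ (D4) ∧ CAP+tail; G-an2-4 gates asym, D1 and NE2/3/4.»

WHY (census V204′ (ii)).  PART 217 needs `D′J = JD` (then `JᴴD′J = D`): the finer multiplier is the coarser one read through the block parent.  A bounded profile that is not a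
union of unit blocks violates this on a thin set only; writing `JᴴD′J = D + E` the cross term of the planted expansion becomes `JGJᴴD′(JWJᴴ) = J(GDW)Jᴴ + J(GEW)Jᴴ`, so the word's
planted defect acquires exactly `J(G·E·W)Jᴴ`, of norm `≤ ‖GE‖·‖W‖` — and `‖GE‖` (NOT `‖E‖`, which is `O(1)`) is what PART 226 makes small.

WHAT THIS FILE PROVES (0 sorry, 0 `def`, nothing cited; `G, D, W, F : n × n`, `G′, D′, W′ : m × m`, `J : m × n`, `Ã : n × m` ANY complex matrices):
* §1 **`planted_word_defect_eq`** (EXACT; ANY `J`): `G′D′W′ − J(GDW)Jᴴ = (G′ − JGJᴴ)D′W′ + JGJᴴ·D′·(W′ − JWJᴴ) + J(G(JᴴD′J − D)W)Jᴴ`.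
* §2 **`opNorm_planted_word_defect_sandwich_le`**: PART 217 §2's letters with `JᴴJ = 1`, `D′J = JD` REPLACED by the one letter `‖G(JᴴD′J − D)‖ ≤ q` ⟹
  `‖Ã(G′D′W′)Ãᴴ − GDW‖ ≤ ακ·p_G + gα·p_W + κ·q + f·(ακ) + gα·f_W`.
* §3 ALONG A TOWER (`FreeTowerLaws Δ A J F r e₀ e₁ f`; no isometry of `J_k` needed): **`oneStepAveragedLaw_plantedWordDefect`**, **`towerLimitRate_plantedWordDefect`** (`TowerLimitRate A r (k ↦ Δ_k⁻¹D_kW_k)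
  (ακC_G + gαC_W + κC_q + ακC_f + gαC_{fW}) ρ` from geometric letters incl. `q_k ≤ C_qρ^k`, `ρ < 1`).
WHAT IT DOES NOT DO: supply `q_k` (PART 226 + the profile's defect geometry, PART 228); two insertions.  SUPPLIER work; NEVER «G-an2-4 closed»; NOT (CONV-C), NOT D1, NOT `BetaPertH`,
NOT continuum, NOT Clay.  Records: `HOME/b2b-balaban-gan24-p3/gen64/README.md`.
-/

noncomputable section

open scoped BigOperators ComplexConjugate Matrix Matrix.Norms.L2Operator
open Filter Topology

namespace Summit.QuantumFields.BalabanUV.Beta.GAN24.PlantedWordDefectLaw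

open Summit.QuantumFields.BalabanUV.T4Continuum
open Summit.QuantumFields.BalabanUV.T4Continuum.CovariantAveragingTower (OneStepAveragedLaw TowerLimitRate towerLimitRate_of_oneStepAveragedLaw)
open Summit.QuantumFields.BalabanUV.T4Continuum.BackgroundResolventTower (FreeTowerLaws opNorm_normalised_le)
open Summit.QuantumFields.BalabanUV.Beta.GAN24.PlantedWordLaw (sandwich_eq)

/-! ## §1 The exact identity with the nesting defect -/

section TwoLevel

variable {m n : Type*} [Fintype m] [DecidableEq m] [Fintype n] [DecidableEq n]
variable {G D W : Matrix n n ℂ} {G' D' W' : Matrix m m ℂ} {J : Matrix m n ℂ}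

omit [DecidableEq m] [DecidableEq n] in
/-- **`planted_word_defect_eq` — THE PLANTED DEFECT OF THE WORD WITH A NON-NESTED MULTIPLIER** (EXACT; ANY `J` — no isometry is used): with the NESTING DEFECT
`E = JᴴD′J − D`, `G′D′W′ − J(GDW)Jᴴ = (G′ − JGJᴴ)·D′W′ + JGJᴴ·D′·(W′ − JWJᴴ) + J·(G·E·W)·Jᴴ` (the cross term `JGJᴴD′JWJᴴ = JG(D + E)WJᴴ`). [our proof] -/
theorem planted_word_defect_eq :
    G' * D' * W' - J * (G * D * W) * Jᴴ
      = (G' - J * G * Jᴴ) * (D' * W') + J * G * Jᴴ * D' * (W' - J * W * Jᴴ) + J * (G * (Jᴴ * D' * J - D) * W) * Jᴴ := by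
  have key : J * G * Jᴴ * D' * (J * W * Jᴴ) = J * (G * D * W) * Jᴴ + J * (G * (Jᴴ * D' * J - D) * W) * Jᴴ := by
    rw [Matrix.mul_sub, Matrix.sub_mul, Matrix.mul_sub, Matrix.sub_mul]
    simp only [Matrix.mul_assoc]
    abel
  have key' : J * G * Jᴴ * D' * (W' - J * W * Jᴴ) = J * G * Jᴴ * D' * W' - (J * (G * D * W) * Jᴴ + J * (G * (Jᴴ * D' * J - D) * W) * Jᴴ) := by
    rw [Matrix.mul_sub, key]
  rw [key', Matrix.sub_mul]
  simp only [Matrix.mul_assoc]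
  abel

end TwoLevel

/-! ## §2 The bound from the planted letters and the defect letter -/

section Bound

variable {m n : Type*} [Fintype m] [DecidableEq m] [Fintype n] [DecidableEq n]
variable {G D W : Matrix n n ℂ} {G' D' W' : Matrix m m ℂ} {J : Matrix m n ℂ}

/-- **`opNorm_planted_word_defect_sandwich_le` — THE ONE-STEP SANDWICH LAW OF `GDW` WITH A NESTING DEFECT** [our proof]:
`‖G‖ ≤ g`, `‖D‖, ‖D′‖ ≤ α`, `‖W‖, ‖W′‖ ≤ κ`, `‖Ã‖, ‖J‖ ≤ 1`, `ÃJ = 1 + F`, `‖G′ − JGJᴴ‖ ≤ p_G`, `‖W′ − JWJᴴ‖ ≤ p_W`, `‖G(JᴴD′J − D)‖ ≤ q`, `‖FG‖ ≤ f`,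
`‖WFᴴ‖ ≤ f_W` ⟹ `‖Ã(G′D′W′)Ãᴴ − GDW‖ ≤ ακ·p_G + gα·p_W + κ·q + f·(ακ) + gα·f_W`. -/
theorem opNorm_planted_word_defect_sandwich_le {g α κ pG pW q f fW : ℝ} (hG : ‖G‖ ≤ g) (hD : ‖D‖ ≤ α) (hD' : ‖D'‖ ≤ α) (hW : ‖W‖ ≤ κ) (hW' : ‖W'‖ ≤ κ)
    {At : Matrix n m ℂ} (hAt : ‖At‖ ≤ 1) (hJ : ‖J‖ ≤ 1) {F : Matrix n n ℂ} (hAJ : At * J = 1 + F)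
    (hpG : ‖G' - J * G * Jᴴ‖ ≤ pG) (hpW : ‖W' - J * W * Jᴴ‖ ≤ pW) (hq : ‖G * (Jᴴ * D' * J - D)‖ ≤ q) (hF : ‖F * G‖ ≤ f) (hfW : ‖W * Fᴴ‖ ≤ fW) :
    ‖At * (G' * D' * W') * Atᴴ - G * D * W‖ ≤ α * κ * pG + g * α * pW + κ * q + f * (α * κ) + g * α * fW := by
  have hg : 0 ≤ g := (norm_nonneg _).trans hG
  have hα : 0 ≤ α := (norm_nonneg _).trans hD
  have hκ : 0 ≤ κ := (norm_nonneg _).trans hW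
  have hf : 0 ≤ f := (norm_nonneg _).trans hF
  have hq0 : 0 ≤ q := (norm_nonneg _).trans hq
  have hpG0 : 0 ≤ pG := (norm_nonneg _).trans hpG
  have hAt' : ‖Atᴴ‖ ≤ 1 := by rw [Matrix.l2_opNorm_conjTranspose]; exact hAt
  have hJ' : ‖Jᴴ‖ ≤ 1 := by rw [Matrix.l2_opNorm_conjTranspose]; exact hJ
  have hAJn : ‖(At * J)ᴴ‖ ≤ 1 := by
    rw [Matrix.l2_opNorm_conjTranspose]
    calc ‖At * J‖ ≤ ‖At‖ * ‖J‖ := Matrix.l2_opNorm_mul _ _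
      _ ≤ 1 * 1 := mul_le_mul hAt hJ (norm_nonneg _) zero_le_one
      _ = 1 := one_mul 1
  have hGD : ‖G * D‖ ≤ g * α := (Matrix.l2_opNorm_mul _ _).trans (mul_le_mul hG hD (norm_nonneg _) hg)
  have hDW : ‖D * W‖ ≤ α * κ := (Matrix.l2_opNorm_mul _ _).trans (mul_le_mul hD hW (norm_nonneg _) hα)
  have hD'W' : ‖D' * W'‖ ≤ α * κ := (Matrix.l2_opNorm_mul _ _).trans (mul_le_mul hD' hW' (norm_nonneg _) hα)
  have hJGJ : ‖J * G * Jᴴ‖ ≤ g := by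
    calc ‖J * G * Jᴴ‖ ≤ ‖J * G‖ * ‖Jᴴ‖ := Matrix.l2_opNorm_mul _ _
      _ ≤ (‖J‖ * ‖G‖) * 1 := mul_le_mul (Matrix.l2_opNorm_mul _ _) hJ' (norm_nonneg _) (mul_nonneg (norm_nonneg _) (norm_nonneg _))
      _ ≤ (1 * g) * 1 := mul_le_mul_of_nonneg_right (mul_le_mul hJ hG (norm_nonneg _) zero_le_one) zero_le_one
      _ = g := by ring
  have hJGJD : ‖J * G * Jᴴ * D'‖ ≤ g * α := (Matrix.l2_opNorm_mul _ _).trans (mul_le_mul hJGJ hD' (norm_nonneg _) hg)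
  -- the defect term `J(GEW)Jᴴ`
  have hGEW : ‖G * (Jᴴ * D' * J - D) * W‖ ≤ q * κ := (Matrix.l2_opNorm_mul _ _).trans (mul_le_mul hq hW (norm_nonneg _) hq0)
  have hdef : ‖J * (G * (Jᴴ * D' * J - D) * W) * Jᴴ‖ ≤ κ * q := by
    calc ‖J * (G * (Jᴴ * D' * J - D) * W) * Jᴴ‖ ≤ ‖J * (G * (Jᴴ * D' * J - D) * W)‖ * ‖Jᴴ‖ := Matrix.l2_opNorm_mul _ _
      _ ≤ (‖J‖ * ‖G * (Jᴴ * D' * J - D) * W‖) * 1 := mul_le_mul (Matrix.l2_opNorm_mul _ _) hJ' (norm_nonneg _) (mul_nonneg (norm_nonneg _) (norm_nonneg _))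
      _ ≤ (1 * (q * κ)) * 1 := mul_le_mul_of_nonneg_right (mul_le_mul hJ hGEW (norm_nonneg _) zero_le_one) zero_le_one
      _ = κ * q := by ring
  -- the planted defect of the word
  have hpl : ‖G' * D' * W' - J * (G * D * W) * Jᴴ‖ ≤ α * κ * pG + g * α * pW + κ * q := by
    rw [planted_word_defect_eq]
    refine (norm_add_le _ _).trans (add_le_add ((norm_add_le _ _).trans (add_le_add ?_ ?_)) hdef)
    · calc _ ≤ ‖G' - J * G * Jᴴ‖ * ‖D' * W'‖ := Matrix.l2_opNorm_mul _ _
        _ ≤ pG * (α * κ) := mul_le_mul hpG hD'W' (norm_nonneg _) hpG0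
        _ = α * κ * pG := by ring
    · exact (Matrix.l2_opNorm_mul _ _).trans (mul_le_mul hJGJD hpW (norm_nonneg _) (mul_nonneg hg hα))
  have hpl0 : 0 ≤ α * κ * pG + g * α * pW + κ * q := (norm_nonneg _).trans hpl
  rw [sandwich_eq hAJ]
  refine (norm_add_le _ _).trans (add_le_add ((norm_add_le _ _).trans (add_le_add ?_ ?_)) ?_)
  · calc _ ≤ ‖At * (G' * D' * W' - J * (G * D * W) * Jᴴ)‖ * ‖Atᴴ‖ := Matrix.l2_opNorm_mul _ _
      _ ≤ (‖At‖ * ‖G' * D' * W' - J * (G * D * W) * Jᴴ‖) * 1 := mul_le_mul (Matrix.l2_opNorm_mul _ _) hAt' (norm_nonneg _) (mul_nonneg (norm_nonneg _) (norm_nonneg _))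
      _ ≤ (1 * (α * κ * pG + g * α * pW + κ * q)) * 1 := mul_le_mul_of_nonneg_right (mul_le_mul hAt hpl (norm_nonneg _) zero_le_one) zero_le_one
      _ = α * κ * pG + g * α * pW + κ * q := by ring
  · calc _ ≤ ‖F * G * (D * W)‖ * ‖(At * J)ᴴ‖ := Matrix.l2_opNorm_mul _ _
      _ ≤ (‖F * G‖ * ‖D * W‖) * 1 := mul_le_mul (Matrix.l2_opNorm_mul _ _) hAJn (norm_nonneg _) (mul_nonneg (norm_nonneg _) (norm_nonneg _))
      _ ≤ (f * (α * κ)) * 1 := mul_le_mul_of_nonneg_right (mul_le_mul hF hDW (norm_nonneg _) hf) zero_le_one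
      _ = f * (α * κ) := mul_one _
  · exact (Matrix.l2_opNorm_mul _ _).trans (mul_le_mul hGD hfW (norm_nonneg _) (mul_nonneg hg hα))

end Bound

/-! ## §3 Along a tower -/

section Tower

variable {ι : ℕ → Type*} [∀ k, Fintype (ι k)] [∀ k, DecidableEq (ι k)]
variable {Δ Dm W : (k : ℕ) → Matrix (ι k) (ι k) ℂ} {A : (k : ℕ) → Matrix (ι k) (ι (k + 1)) ℂ}
  {J : (k : ℕ) → Matrix (ι (k + 1)) (ι k) ℂ} {F : (k : ℕ) → Matrix (ι k) (ι k) ℂ} {r g α κ : ℝ} {e₀ e₁ f pG pW q fW : ℕ → ℝ}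

/-- **`oneStepAveragedLaw_plantedWordDefect` — THE ONE-STEP AVERAGED LAW OF `k ↦ Δ_k⁻¹D_kW_k` WITH A NESTING DEFECT** [our proof]: over
`FreeTowerLaws Δ A J F r e₀ e₁ f` (which gives `‖J_k‖ ≤ 1`; NO isometry of `J_k` is used), with `‖Δ_k⁻¹‖ ≤ g`, `‖D_k‖ ≤ α`, `‖W_k‖ ≤ κ` and the DISPLAYED letters `‖Δ_{k+1}⁻¹ − J_kΔ_k⁻¹J_kᴴ‖ ≤ p_G k`,
`‖W_{k+1} − J_kW_kJ_kᴴ‖ ≤ p_W k`, `‖Δ_k⁻¹(J_kᴴD_{k+1}J_k − D_k)‖ ≤ q k`, `‖W_kF_kᴴ‖ ≤ f_W k`: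
`OneStepAveragedLaw A r (k ↦ Δ_k⁻¹D_kW_k) (k ↦ ακ·p_G k + gα·p_W k + κ·q k + f k·(ακ) + gα·f_W k)`. -/
theorem oneStepAveragedLaw_plantedWordDefect (hr : 0 < r) (hfree : FreeTowerLaws Δ A J F r e₀ e₁ f)
    (hG : ∀ k, ‖(Δ k)⁻¹‖ ≤ g) (hD : ∀ k, ‖Dm k‖ ≤ α) (hW : ∀ k, ‖W k‖ ≤ κ)
    (hpG : ∀ k, ‖(Δ (k + 1))⁻¹ - J k * (Δ k)⁻¹ * (J k)ᴴ‖ ≤ pG k) (hpW : ∀ k, ‖W (k + 1) - J k * W k * (J k)ᴴ‖ ≤ pW k)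
    (hq : ∀ k, ‖(Δ k)⁻¹ * ((J k)ᴴ * Dm (k + 1) * J k - Dm k)‖ ≤ q k) (hfW : ∀ k, ‖W k * (F k)ᴴ‖ ≤ fW k) :
    OneStepAveragedLaw A r (fun k => (Δ k)⁻¹ * Dm k * W k) (fun k => α * κ * pG k + g * α * pW k + κ * q k + f k * (α * κ) + g * α * fW k) := by
  intro k
  have hs0 : 0 < Real.sqrt r := Real.sqrt_pos.mpr hr
  set At : Matrix (ι k) (ι (k + 1)) ℂ := (((Real.sqrt r : ℝ) : ℂ)) • A k with hAt_def
  have hAt : ‖At‖ ≤ 1 := opNorm_normalised_le hr (hfree.opNorm_A_sq_le k)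
  have hAJ : At * J k = 1 + F k := by rw [hAt_def, Matrix.smul_mul]; exact hfree.A_mul_J k
  have key := opNorm_planted_word_defect_sandwich_le (G := (Δ k)⁻¹) (G' := (Δ (k + 1))⁻¹) (D := Dm k) (D' := Dm (k + 1)) (W := W k) (W' := W (k + 1)) (J := J k)
    (hG k) (hD k) (hD (k + 1)) (hW k) (hW (k + 1)) hAt (hfree.opNorm_J_le k) hAJ (hpG k) (hpW k) (hq k) (hfree.opNorm_F_mul_inv_le k) (hfW k)
  have hss : star ((((Real.sqrt r : ℝ) : ℂ))) = (((Real.sqrt r : ℝ) : ℂ)) := Complex.conj_ofReal _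
  have hsq : ((((Real.sqrt r : ℝ) : ℂ))) * (((Real.sqrt r : ℝ) : ℂ)) = (r : ℂ) := by
    rw [← Complex.ofReal_mul, Real.mul_self_sqrt hr.le]
  have hrC : (r : ℂ) ≠ 0 := by exact_mod_cast hr.ne'
  have e : A k * ((Δ (k + 1))⁻¹ * Dm (k + 1) * W (k + 1)) * (A k)ᴴ - ((r : ℂ))⁻¹ • ((Δ k)⁻¹ * Dm k * W k)
      = ((r : ℂ))⁻¹ • (At * ((Δ (k + 1))⁻¹ * Dm (k + 1) * W (k + 1)) * Atᴴ - (Δ k)⁻¹ * Dm k * W k) := by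
    rw [hAt_def, Matrix.conjTranspose_smul, hss, Matrix.smul_mul, Matrix.smul_mul, Matrix.mul_smul, smul_smul, hsq, smul_sub, smul_smul,
      inv_mul_cancel₀ hrC, one_smul]
  rw [e, norm_smul, norm_inv, Complex.norm_real, Real.norm_of_nonneg hr.le]
  exact mul_le_mul_of_nonneg_left key (inv_nonneg.mpr hr.le)

/-- **`towerLimitRate_plantedWordDefect` — THE TOWER LIMIT WITH RATE FOR THE WORD WITH AN ALMOST NESTED BOUNDED MULTIPLIER** [our proof]: if
`p_G k ≤ C_Gρ^k`, `p_W k ≤ C_Wρ^k`, `q k ≤ C_qρ^k`, `f k ≤ C_fρ^k`, `f_W k ≤ C_{fW}ρ^k` with `ρ < 1`, then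
`TowerLimitRate A r (k ↦ Δ_k⁻¹D_kW_k) (ακC_G + gαC_W + κC_q + ακC_f + gαC_{fW}) ρ`. -/
theorem towerLimitRate_plantedWordDefect (hr : 0 < r) (hfree : FreeTowerLaws Δ A J F r e₀ e₁ f)
    (hG : ∀ k, ‖(Δ k)⁻¹‖ ≤ g) (hD : ∀ k, ‖Dm k‖ ≤ α) (hW : ∀ k, ‖W k‖ ≤ κ)
    (hpG : ∀ k, ‖(Δ (k + 1))⁻¹ - J k * (Δ k)⁻¹ * (J k)ᴴ‖ ≤ pG k) (hpW : ∀ k, ‖W (k + 1) - J k * W k * (J k)ᴴ‖ ≤ pW k)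
    (hq : ∀ k, ‖(Δ k)⁻¹ * ((J k)ᴴ * Dm (k + 1) * J k - Dm k)‖ ≤ q k) (hfW : ∀ k, ‖W k * (F k)ᴴ‖ ≤ fW k)
    {ρ CG CW Cq Cf CfW : ℝ} (hρ1 : ρ < 1) (hcG : ∀ k, pG k ≤ CG * ρ ^ k) (hcW : ∀ k, pW k ≤ CW * ρ ^ k) (hcq : ∀ k, q k ≤ Cq * ρ ^ k)
    (hcf : ∀ k, f k ≤ Cf * ρ ^ k) (hcfW : ∀ k, fW k ≤ CfW * ρ ^ k) :
    TowerLimitRate A r (fun k => (Δ k)⁻¹ * Dm k * W k) (α * κ * CG + g * α * CW + κ * Cq + α * κ * Cf + g * α * CfW) ρ := by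
  have hg : 0 ≤ g := (norm_nonneg _).trans (hG 0)
  have hα : 0 ≤ α := (norm_nonneg _).trans (hD 0)
  have hκ : 0 ≤ κ := (norm_nonneg _).trans (hW 0)
  have hlaw : OneStepAveragedLaw A r (fun k => (Δ k)⁻¹ * Dm k * W k) (fun k => (α * κ * CG + g * α * CW + κ * Cq + α * κ * Cf + g * α * CfW) * ρ ^ k) := by
    intro k
    refine (oneStepAveragedLaw_plantedWordDefect hr hfree hG hD hW hpG hpW hq hfW k).trans (mul_le_mul_of_nonneg_left ?_ (inv_nonneg.mpr hr.le))
    have hgα : 0 ≤ g * α := mul_nonneg hg hα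
    have hακ : 0 ≤ α * κ := mul_nonneg hα hκ
    have a1 : α * κ * pG k ≤ α * κ * (CG * ρ ^ k) := mul_le_mul_of_nonneg_left (hcG k) hακ
    have a2 : g * α * pW k ≤ g * α * (CW * ρ ^ k) := mul_le_mul_of_nonneg_left (hcW k) hgα
    have a3 : κ * q k ≤ κ * (Cq * ρ ^ k) := mul_le_mul_of_nonneg_left (hcq k) hκ
    have a4 : f k * (α * κ) ≤ (Cf * ρ ^ k) * (α * κ) := mul_le_mul_of_nonneg_right (hcf k) hακ
    have a5 : g * α * fW k ≤ g * α * (CfW * ρ ^ k) := mul_le_mul_of_nonneg_left (hcfW k) hgα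
    nlinarith [a1, a2, a3, a4, a5]
  exact towerLimitRate_of_oneStepAveragedLaw A hr hfree.opNorm_A_sq_le _ hρ1 hlaw

end Tower

end Summit.QuantumFields.BalabanUV.Beta.GAN24.PlantedWordDefectLaw

end
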